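import Summits.QuantumAdvantage.AdviceFreeQNC0.ApMaj3Triple
import Summits.QuantumAdvantage.AdviceFreeQNC0.HardcoreCylinder
import HarnessLib

/-!
# Cell qa-qnc0 — TOY TARGET `ApMaj3Lt` PROVED: AP-MAJ₃ far templates are not near-perfect
(planner qa-qnc0-p1 g19, ROUND-18 §3.9–3.10; `exp19/Sketch19.lean` §8, def `ApMaj3Lt` VERBATIM)

`apMaj3Lt : ApMaj3Lt` (via `apMaj3Lt_of : HardcoreCylinderLB → ApMaj3Lt` and `hardcoreCylinderLB`): some
absolute `θ < 1` bounds, uniformly in the offset `h ≥ 2` (`4h < n`, `n` large), the number of odd patterns on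
which the AP-MAJ₃ far template `z_j = t_j(x) ⊕ MAJ(x_{j+h}, x_{j+2h}, x_{j+3h})` satisfies the ring relation.

Proof (ROUND-18 §3.10): on the cylinder `E = {J_{-h} = 1, J_0 = J_h = J_{2h} = J_{3h} = 0}` (`≥ c₀·2^{n-1}` odd
patterns, `hardcoreCylinderLB`), the triple identity `apMaj3_triple` says that an ODD number of the four flips
`x^F`, `F ∈ evenSubsets {h, 2h, 3h}`, win — so at least one loses; each flip is an injection of `E` into the odd
losers (`kline_flipEven`), hence `#LOSE ≥ #E/4` and `θ = 1 − c₀/4`.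

WHAT THIS IS NOT: a toy dense family only; crux 22907 untouched; separation NOT moved.
-/

namespace Summit.QuantumAdvantage.AdviceFreeQNC0.Fib19

open Finset Literature.Computability.QuantumComplexity Literature.Computability.QuantumComplexity.RingHLF
open Fin.CommRing

variable {n : ℕ}

/-- TOY TARGET: AP-MAJ₃ far templates are not near-perfect (uniformly in `h ≥ 2`).  (Sketch19 §8, verbatim.) -/
def ApMaj3Lt : Prop :=
  open scoped Classical in
  ∃ θ : ℝ, θ < 1 ∧ ∀ h : ℕ, 2 ≤ h → ∃ n₀ : ℕ, ∀ n ≥ n₀, 4 * h < n →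
    ((univ.filter fun x : Fin n → Bool => OddZeros x ∧ Rel x (apMaj3 h x)).card : ℝ) ≤ θ * (2 : ℝ) ^ (n - 1)

/-- `nxt j = j + 1` in the ring `Fin n`. -/
theorem nxt_eq_add_one [NeZero n] (j : Fin n) : nxt j = j + 1 := by
  have e := shift_eq_add 1 j
  rw [Nat.cast_one] at e
  exact e

/-- From an odd number of hits in a family of even size, some member is missed (any decidability
instance `hdec`, taken implicitly). -/
theorem exists_not_of_card_filter_odd {α : Type*} (s : Finset α) (p : α → Prop) {hdec : DecidablePred p}
    (hs : s.card % 2 = 0) (h : (s.filter p).card % 2 = 1) : ∃ a ∈ s, ¬ p a := by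
  by_contra hall
  push Not at hall
  rw [Finset.filter_true_of_mem hall] at h
  omega

/-- **`ApMaj3Lt` from the cylinder bound** (Sketch19 §8 `apMaj3Lt_of`). -/
theorem apMaj3Lt_of (hC : HardcoreCylinderLB) : ApMaj3Lt := by
  obtain ⟨c₀, hc₀, n₁, hcyl⟩ := hC
  refine ⟨1 - c₀ / 4, by linarith, fun h hh => ⟨n₁, fun n hn hn4 => ?_⟩⟩
  haveI : NeZero n := ⟨by omega⟩
  have hn3 : 3 ≤ n := by omega
  have sh : ∀ (m : ℕ) (j : Fin n), shift m j = j + (m : Fin n) := fun m j => shift_eq_add m j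
  have c2 : ((2 * h : ℕ) : Fin n) = 2 * (h : Fin n) := by rw [Nat.cast_mul, Nat.cast_ofNat]
  have c3 : ((3 * h : ℕ) : Fin n) = 3 * (h : Fin n) := by rw [Nat.cast_mul, Nat.cast_ofNat]
  have cn : ((n - h : ℕ) : Fin n) = -(h : Fin n) := by
    rw [Nat.cast_sub (by omega : h ≤ n), Fin.natCast_self, zero_sub]
  set H : Fin n := (h : Fin n) with hH
  -- `k·H ≠ 0` and `k·H ≠ ±1` for small `k`
  have hval : ∀ m : ℕ, ((m : Fin n) : Fin n).val = m % n := fun m => Fin.val_natCast m n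
  have cast_ne_zero : ∀ m : ℕ, 0 < m → m < n → (m : Fin n) ≠ 0 := fun m h0 hm =>
    natCast_ne_zero_of_lt h0 hm
  have cast_ne_one : ∀ m : ℕ, 2 ≤ m → m < n → (m : Fin n) ≠ 1 := by
    intro m h2 hm e
    have := congrArg Fin.val e
    rw [hval, Nat.mod_eq_of_lt hm, Fin.val_one', Nat.mod_eq_of_lt (by omega)] at this
    omega
  have neg_cast_ne_one : ∀ m : ℕ, m + 1 < n → -(m : Fin n) ≠ 1 := by
    intro m hm e
    have e' : ((m + 1 : ℕ) : Fin n) = 0 := by rw [Nat.cast_add, Nat.cast_one, ← e, add_neg_cancel]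
    rw [Fin.natCast_eq_zero] at e'
    exact absurd (Nat.le_of_dvd (by omega) e') (by omega)
  have N1 : H ≠ 0 := cast_ne_zero h (by omega) (by omega)
  have N2 : (2 : Fin n) * H ≠ 0 := by rw [← c2]; exact cast_ne_zero _ (by omega) (by omega)
  have N3 : (3 : Fin n) * H ≠ 0 := by rw [← c3]; exact cast_ne_zero _ (by omega) (by omega)
  have N4 : (4 : Fin n) * H ≠ 0 := by
    have c4 : ((4 * h : ℕ) : Fin n) = 4 * H := by rw [Nat.cast_mul, Nat.cast_ofNat]
    rw [← c4]; exact cast_ne_zero _ (by omega) (by omega)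
  have O1 : H ≠ 1 := cast_ne_one h hh (by omega)
  have O2 : (2 : Fin n) * H ≠ 1 := by rw [← c2]; exact cast_ne_one _ (by omega) (by omega)
  have O3 : (3 : Fin n) * H ≠ 1 := by rw [← c3]; exact cast_ne_one _ (by omega) (by omega)
  have P1 : -H ≠ 1 := neg_cast_ne_one h (by omega)
  have P2 : -((2 : Fin n) * H) ≠ 1 := by rw [← c2]; exact neg_cast_ne_one _ (by omega)
  have P3 : -((3 : Fin n) * H) ≠ 1 := by rw [← c3]; exact neg_cast_ne_one _ (by omega)
  have Z1 : (0 : Fin n) ≠ 1 := by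
    intro e; have := congrArg Fin.val e
    rw [Fin.val_zero, Fin.val_one', Nat.mod_eq_of_lt (by omega)] at this; omega
  have ne_of : ∀ (k : Fin n) {u v : Fin n}, k ≠ 0 → u - v = k → u ≠ v :=
    fun k u v hk huv e => hk (by rw [← huv, e, sub_self])
  -- the cylinder `J_{-h} = 1, J_0 = J_h = J_{2h} = J_{3h} = 0` around `s = 0`
  set S : Finset (Fin n) := {-H, 0, H, 2 * H, 3 * H} with hS
  set σ : Fin n → Bool := fun i => if i = -H then true else false with hσ
  have hS7 : S.card ≤ 7 := card_le_five.trans (by norm_num)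
  have hσS : ∀ i ∈ S, nxt i ∈ S → ¬ (σ i = false ∧ σ (nxt i) = false) := by
    rintro i hi hni ⟨h1, h2⟩
    have hi' : i ≠ -H := fun e => by simp [hσ, e] at h1
    have hni' : nxt i ≠ -H := fun e => by simp [hσ, e] at h2
    rw [nxt_eq_add_one] at hni hni'
    simp only [hS, mem_insert, mem_singleton] at hi hni
    rcases hi with e | e | e | e | e
    · exact hi' e
    all_goals
      rcases hni with f | f | f | f | f
      · exact hni' f
      all_goals rw [e] at f
    -- sixteen differences `b - a`, none equal to `1`
    · exact Z1 (by linear_combination -f)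
    · exact O1 (by linear_combination -f)
    · exact O2 (by linear_combination -f)
    · exact O3 (by linear_combination -f)
    · exact P1 (by linear_combination -f)
    · exact Z1 (by linear_combination -f)
    · exact O1 (by linear_combination -f)
    · exact O2 (by linear_combination -f)
    · exact P2 (by linear_combination -f)
    · exact P1 (by linear_combination -f)
    · exact Z1 (by linear_combination -f)
    · exact O1 (by linear_combination -f)
    · exact P3 (by linear_combination -f)
    · exact P2 (by linear_combination -f)
    · exact P1 (by linear_combination -f)
    · exact Z1 (by linear_combination -f)
  have hcyl' := hcyl n hn S hS7 σ hσS
  -- the event `E` (in `IsOdd` form) and the four flips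
  set E : Finset (Fin n → Bool) := univ.filter fun x : Fin n → Bool => IsOdd x ∧ kline x (-H) = true ∧
    kline x 0 = false ∧ kline x H = false ∧ kline x (2 * H) = false ∧ kline x (3 * H) = false with hE
  have hEcard : c₀ * (2 : ℝ) ^ (n - 1) ≤ (E.card : ℝ) := by
    refine le_trans hcyl' ((Nat.cast_le (α := ℝ)).2 (card_le_card fun x hx => ?_))
    simp only [mem_filter, mem_univ, true_and] at hx
    obtain ⟨ho, hk⟩ := hx
    rw [hE, mem_filter]
    have k1 := hk (-H) (by simp [hS])
    have k2 := hk 0 (by simp [hS])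
    have k3 := hk H (by simp [hS])
    have k4 := hk (2 * H) (by simp [hS])
    have k5 := hk (3 * H) (by simp [hS])
    have e0 : (0 : Fin n) ≠ -H := fun e => N1 (by linear_combination e)
    have e1 : H ≠ -H := fun e => N2 (by linear_combination e)
    have e2 : 2 * H ≠ -H := fun e => N3 (by linear_combination e)
    have e3 : 3 * H ≠ -H := fun e => N4 (by linear_combination e)
    simp only [hσ, e0, e1, e2, e3, if_false, if_true] at k1 k2 k3 k4 k5
    exact ⟨mem_univ _, (isOdd_iff_oddZeros x).2 ho, k1, k2, k3, k4, k5⟩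
  set 𝓕 : Finset (Finset (Fin n)) := evenSubsets ({H, 2 * H, 3 * H} : Finset (Fin n)) with h𝓕def
  have d12 : H ≠ 2 * H := ne_of (-H) (neg_ne_zero.2 N1) (by ring)
  have d13 : H ≠ 3 * H := ne_of (-(2 * H)) (neg_ne_zero.2 N2) (by ring)
  have d23 : 2 * H ≠ 3 * H := ne_of (-H) (neg_ne_zero.2 N1) (by ring)
  have h𝓕card : 𝓕.card = 4 := by
    rw [card_eq_sum_ones, h𝓕def, sum_evenSubsets_triple d12 d13 d23]
  have h𝓕mem : ∀ F ∈ 𝓕, F ⊆ {H, 2 * H, 3 * H} ∧ F.card % 2 = 0 := by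
    intro F hF
    simp only [h𝓕def, evenSubsets, mem_filter, mem_powerset] at hF
    exact hF
  -- for each `x ∈ E`, some flip loses
  have hlose : ∀ x ∈ E, ∃ F ∈ 𝓕, ¬ Rel (flipAt x F) (apMaj3 h (flipAt x F)) := by
    intro x hx
    rw [hE, mem_filter] at hx
    obtain ⟨-, ho, km, k0, k1, k2, k3⟩ := hx
    have htri := apMaj3_triple h hh hn4 x ho 0 (by rw [sh, zero_add]; exact k1)
      (by rw [sh, c2, zero_add]; exact k2) (by rw [sh, c3, zero_add]; exact k3)
    simp only [sh, c2, c3, cn, zero_add, ← hH, km, k0] at htri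
    exact exists_not_of_card_filter_odd 𝓕 _ (by rw [h𝓕card]) htri
  -- counting: each flip injects `E ∩ {x : x^F loses}` into the odd losers
  set LOSE := univ.filter fun y : Fin n → Bool => IsOdd y ∧ ¬ Rel y (apMaj3 h y) with hLOSE
  set WIN := univ.filter fun y : Fin n → Bool => IsOdd y ∧ Rel y (apMaj3 h y) with hWIN
  have hEle : E.card ≤ 4 * LOSE.card := by
    have hsub : E ⊆ 𝓕.biUnion fun F => E.filter fun x => ¬ Rel (flipAt x F) (apMaj3 h (flipAt x F)) := by
      intro x hx
      obtain ⟨F, hF, hnot⟩ := hlose x hx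
      rw [mem_biUnion]
      exact ⟨F, hF, mem_filter.2 ⟨hx, hnot⟩⟩
    refine le_trans (card_le_card hsub) (le_trans card_biUnion_le ?_)
    have hF : ∀ F ∈ 𝓕, (E.filter fun x => ¬ Rel (flipAt x F) (apMaj3 h (flipAt x F))).card ≤ LOSE.card := by
      intro F hF
      refine card_le_card_of_injOn (fun x => flipAt x F) (fun x hx => ?_) (fun x _ y _ hxy => by
        have e := congrArg (fun w : Fin n → Bool => flipAt w F) hxy
        simpa only [flipAt_flipAt] using e)
      rw [mem_coe, mem_filter, hE, mem_filter] at hx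
      obtain ⟨⟨-, ho, -, -, k1, k2, k3⟩, hnot⟩ := hx
      have hpart : ∀ q ∈ F, kline x q = false := by
        intro q hq
        have hq' := (h𝓕mem F hF).1 hq
        simp only [mem_insert, mem_singleton] at hq'
        rcases hq' with rfl | rfl | rfl
        · exact k1
        · exact k2
        · exact k3
      rw [mem_coe, hLOSE, mem_filter]
      exact ⟨mem_univ _, (kline_flipEven hn3 x ho F hpart (h𝓕mem F hF).2).1, hnot⟩
    calc ∑ F ∈ 𝓕, (E.filter fun x => ¬ Rel (flipAt x F) (apMaj3 h (flipAt x F))).card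
        ≤ ∑ F ∈ 𝓕, LOSE.card := sum_le_sum hF
      _ = 4 * LOSE.card := by rw [sum_const, h𝓕card, smul_eq_mul]
  have hsplit : WIN.card + LOSE.card = 2 ^ (n - 1) := by
    rw [← card_isOdd (by omega : 1 ≤ n), ← Finset.card_filter_add_card_filter_not
      (s := univ.filter fun y : Fin n → Bool => IsOdd y) (fun y => Rel y (apMaj3 h y)), filter_filter,
      filter_filter]
  -- real arithmetic
  have hfin : (WIN.card : ℝ) ≤ (1 - c₀ / 4) * (2 : ℝ) ^ (n - 1) := by
    have h1 : ((WIN.card + LOSE.card : ℕ) : ℝ) = (2 : ℝ) ^ (n - 1) := by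
      rw [hsplit, Nat.cast_pow, Nat.cast_ofNat]
    rw [Nat.cast_add] at h1
    have h2 : (E.card : ℝ) ≤ 4 * (LOSE.card : ℝ) := by
      have := (Nat.cast_le (α := ℝ)).2 hEle
      rw [Nat.cast_mul, Nat.cast_ofNat] at this
      exact this
    linarith
  refine le_trans ?_ hfin
  refine (Nat.cast_le (α := ℝ)).2 (card_le_card fun x hx => ?_)
  simp only [mem_filter, mem_univ, true_and] at hx
  rw [hWIN, mem_filter]
  exact ⟨mem_univ _, (isOdd_iff_oddZeros x).2 hx.1, hx.2⟩

/-- **`ApMaj3Lt` — PROVED unconditionally** (`hardcoreCylinderLB`). -/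
theorem apMaj3Lt : ApMaj3Lt := apMaj3Lt_of hardcoreCylinderLB

end Summit.QuantumAdvantage.AdviceFreeQNC0.Fib19
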